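import Literature.Probability.Percolation.MarkedLoopLawSlide
import HarnessLib

/-!
# Pendant attachments with TWO roots: links after attaching a path between two faces («PENDANT-TWO-ROOTS»)

Topic `Literature/Probability/Percolation`; generic-`k` layer of the marked-loop (Khristoforov–Smirnov) lineage; a rider on `MarkedLoopLawSlide.lean` §1 (#848: `reachable_union_pendant`,
`reachable_union_pendant_root` — a PENDANT edge set `E` whose bonds live on a set `S` of otherwise edge-free faces and ONE root face changes no link off `S`). The contraction
identity F2 (HOME `FINDING-BSPAN-SLIDE-INDUCTION.md` §2; «LAW-ATTACH-SPLIT» is its first half) and the two-cell cap identity (`FINDING-TWO-CELL-CAP-IDENTITY.md`) attach the WHOLE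
outer path of the hexagon, whose bonds live on `S` and TWO root faces `P`, `Q` touching `G`: a strand entering the path at `P` leaves it at `Q`. This file is the corresponding
`D`-free link bookkeeping for the side graph (`FivePoint.N5.sideGraph`):

* `reachable_of_walk_union_pendant₂` — excursion cutting: a walk of the side graph of `ξ ∪ E` ending off `S` reduces, if it starts off `S`, to a `ξ`-walk to its end OR a
  `ξ`-walk to one root plus «the other root is `ξ`-linked to the end»; if it starts on `S`, to «some root is `ξ`-linked to the end»;
* ★★ `reachable_union_pendant₂_iff` — for `X, Y ∉ S`, when `E` joins the two roots inside itself: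
  `Reachable_{ξ ∪ E} X Y ↔ Reachable_ξ X Y ∨ (Reachable_ξ X P ∧ Reachable_ξ Q Y) ∨ (Reachable_ξ X Q ∧ Reachable_ξ P Y)` — the two roots are IDENTIFIED, nothing else changes;
* ★ `reachable_union_pendant₂_root_iff` — for `A ∈ S` joined to both roots inside `E` and `Y ∉ S`: `Reachable_{ξ ∪ E} A Y ↔ Reachable_ξ P Y ∨ Reachable_ξ Q Y`.

## References
* M. Khristoforov, S. Smirnov, *Percolation and O(1) loop model*, arXiv:2111.15612 (2021), §1.2 (arXiv v1 p. 2: «IP(ξ) is a union of disjoint paths, matching marked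
  points»).
* P. A. Pearce, V. Rittenberg, J. de Gier, B. Nienhuis, *Temperley–Lieb stochastic processes*, J. Phys. A 35 (2002) L661–L668, §2 (the monoid: contraction joins two strands).

## Mathlib / tree
Mathlib: `SimpleGraph.Walk` (induction on length), `SimpleGraph.Reachable.trans/symm/mono`. Tree: `FivePointNormalisation` (`N5.sideGraph`, `side_oppFace_oppIdx`), `FivePointCoreTriples`
(`N5.ht2_sideGraph_mono`), `MarkedLoopLawSlide` (the one-root versions, for comparison).
-/

open Finset

namespace Literature.Probability.Percolation.MarkedLoops

open Literature.Probability.Percolation Literature.Probability.LatticeModels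
open Literature.Probability.Percolation.FivePoint (side)
open Literature.Probability.Percolation.FivePoint.N5 (sideGraph side_oppFace_oppIdx ht2_sideGraph_mono)

section TwoRoots

variable {ξ E : Finset (Sym2 (Site 2))} {S : Finset HexVertex} {P Q : HexVertex}

/-- **excursion cutting with two roots.** `E` is attached to `ξ` through the faces `S` with roots `P`, `Q`: every side of a face of `S` lying in `ξ ∪ E` lies in `E`, every face off
`S ∪ {P, Q}` has no side in `E`, and `ξ`, `E` are disjoint. Then a walk of the side graph of `ξ ∪ E` ending at `Y ∉ S` yields: from a start off `S`, a `ξ`-link to `Y`, or a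
`ξ`-link to a root whose partner root is `ξ ∪ E`-… — precisely: `ξ`-linked to `Y`, or (`ξ`-linked to `P` or equal) with `Q` reaching `Y` in fewer `ξ ∪ E`-steps handled by
induction, giving the three-way disjunction below; from a start in `S`, a root `ξ`-reaches `Y` (through the rest of the walk).
[cite: KhristoforovSmirnov2021, §1.2 (arXiv v1 p. 2: `IP(ξ)` is a union of disjoint paths)] -/
theorem reachable_of_walk_union_pendant₂ (hS : ∀ F ∈ S, ∀ j : Fin 3, side F j ∈ ξ ∪ E → side F j ∈ E)
    (hR : ∀ F, F ∉ S → F ≠ P → F ≠ Q → ∀ j : Fin 3, side F j ∉ E) (hdisj : Disjoint ξ E) {Y : HexVertex} (hY : Y ∉ S) (n : ℕ) :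
    ∀ {X : HexVertex} (p : (sideGraph (ξ ∪ E)).Walk X Y), p.length ≤ n →
      (X ∉ S → (sideGraph ξ).Reachable X Y ∨ ((sideGraph ξ).Reachable X P ∧ ((sideGraph ξ).Reachable P Y ∨ (sideGraph ξ).Reachable Q Y)) ∨
          ((sideGraph ξ).Reachable X Q ∧ ((sideGraph ξ).Reachable P Y ∨ (sideGraph ξ).Reachable Q Y))) ∧
        (X ∈ S → (sideGraph ξ).Reachable P Y ∨ (sideGraph ξ).Reachable Q Y) := by
  induction n with
  | zero =>
    intro X p hp
    cases p with
    | nil => exact ⟨fun _ => Or.inl (SimpleGraph.Reachable.refl _), fun h => absurd h hY⟩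
    | cons h q => simp at hp
  | succ n ih =>
    intro X p hp
    cases p with
    | nil => exact ⟨fun _ => Or.inl (SimpleGraph.Reachable.refl _), fun h => absurd h hY⟩
    | cons hadj q =>
      rename_i X₁
      rw [SimpleGraph.Walk.length_cons] at hp
      obtain ⟨j, hX₁, hj⟩ := hadj
      have hq := ih q (by omega)
      have hjX₁ : side X₁ (oppIdx X j) = side X j := by rw [hX₁, side_oppFace_oppIdx]
      -- a root reached from `X₁` transfers to `X` when `X ξ-reaches X₁`
      have lift : (sideGraph ξ).Adj X X₁ → X₁ ∉ S →
          ((sideGraph ξ).Reachable X Y ∨ ((sideGraph ξ).Reachable X P ∧ ((sideGraph ξ).Reachable P Y ∨ (sideGraph ξ).Reachable Q Y)) ∨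
            ((sideGraph ξ).Reachable X Q ∧ ((sideGraph ξ).Reachable P Y ∨ (sideGraph ξ).Reachable Q Y))) := by
        intro ha h1
        rcases hq.1 h1 with h | ⟨hP, hr⟩ | ⟨hQ, hr⟩
        · exact Or.inl (ha.reachable.trans h)
        · exact Or.inr (Or.inl ⟨ha.reachable.trans hP, hr⟩)
        · exact Or.inr (Or.inr ⟨ha.reachable.trans hQ, hr⟩)
      constructor
      · intro hX
        rcases Finset.mem_union.1 hj with hjξ | hjE
        · -- a `ξ`-step: the next face is off `S`
          have hX₁S : X₁ ∉ S := by
            intro h1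
            have := hS X₁ h1 (oppIdx X j) (by rw [hjX₁]; exact hj)
            rw [hjX₁] at this
            exact Finset.disjoint_left.1 hdisj hjξ this
          exact lift ⟨j, hX₁, hjξ⟩ hX₁S
        · -- an `E`-step from off `S`: `X` is a root; the walk continues from `X₁ ∈ S ∪ {P, Q}`
          have hXR : X = P ∨ X = Q := by
            by_contra hne
            push Not at hne
            exact hR X hX hne.1 hne.2 j hjE
          -- whatever happens next, some root `ξ`-reaches `Y`; and `X` is a root
          have hroot : (sideGraph ξ).Reachable P Y ∨ (sideGraph ξ).Reachable Q Y := by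
            by_cases hX₁S : X₁ ∈ S
            · exact hq.2 hX₁S
            · -- `X₁` is off `S` with an `E`-side: it is a root too
              have hX₁R : X₁ = P ∨ X₁ = Q := by
                by_contra hne
                push Not at hne
                exact hR X₁ hX₁S hne.1 hne.2 _ (hjX₁ ▸ hjE)
              rcases hq.1 hX₁S with h | ⟨hP, hr⟩ | ⟨hQ, hr⟩
              · rcases hX₁R with rfl | rfl
                · exact Or.inl h
                · exact Or.inr h
              · exact hr
              · exact hr
          rcases hXR with rfl | rfl
          · rcases hroot with h | h
            · exact Or.inl h
            · exact Or.inr (Or.inl ⟨SimpleGraph.Reachable.refl _, Or.inr h⟩)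
          · rcases hroot with h | h
            · exact Or.inr (Or.inr ⟨SimpleGraph.Reachable.refl _, Or.inl h⟩)
            · exact Or.inl h
      · intro hX
        -- a step from a face of `S` runs along a bond of `E`, to a face of `S` or to a root
        have hjE : side X j ∈ E := hS X hX j hj
        by_cases hX₁S : X₁ ∈ S
        · exact hq.2 hX₁S
        · have hX₁R : X₁ = P ∨ X₁ = Q := by
            by_contra hne
            push Not at hne
            exact hR X₁ hX₁S hne.1 hne.2 (oppIdx X j) (by rw [hjX₁]; exact hjE)
          rcases hq.1 hX₁S with h | ⟨-, hr⟩ | ⟨-, hr⟩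
          · rcases hX₁R with rfl | rfl
            · exact Or.inl h
            · exact Or.inr h
          · exact hr
          · exact hr

/-- ★★ **ATTACHING A PATH BETWEEN TWO ROOTS IDENTIFIES THEM AND CHANGES NOTHING ELSE**: for faces `X, Y ∉ S`, if `E` joins `P` to `Q` inside itself then
`X ~ Y` in `ξ ∪ E` iff `X ~ Y` in `ξ`, or `X ~ P` and `Q ~ Y` in `ξ`, or `X ~ Q` and `P ~ Y` in `ξ`.
[cite: KhristoforovSmirnov2021, §1.2 (arXiv v1 p. 2: `IP(ξ)` is a union of disjoint paths); PearceRittenbergDeGierNienhuis2002, §2 (contraction joins two strands)] -/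
theorem reachable_union_pendant₂_iff (hS : ∀ F ∈ S, ∀ j : Fin 3, side F j ∈ ξ ∪ E → side F j ∈ E)
    (hR : ∀ F, F ∉ S → F ≠ P → F ≠ Q → ∀ j : Fin 3, side F j ∉ E) (hdisj : Disjoint ξ E) (hPQ : (sideGraph E).Reachable P Q) {X Y : HexVertex} (hX : X ∉ S) (hY : Y ∉ S) :
    (sideGraph (ξ ∪ E)).Reachable X Y ↔ (sideGraph ξ).Reachable X Y ∨ ((sideGraph ξ).Reachable X P ∧ (sideGraph ξ).Reachable Q Y) ∨
      ((sideGraph ξ).Reachable X Q ∧ (sideGraph ξ).Reachable P Y) := by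
  have hξ : sideGraph ξ ≤ sideGraph (ξ ∪ E) := ht2_sideGraph_mono Finset.subset_union_left
  have hE : sideGraph E ≤ sideGraph (ξ ∪ E) := ht2_sideGraph_mono Finset.subset_union_right
  have hPQ' : (sideGraph (ξ ∪ E)).Reachable P Q := hPQ.mono hE
  constructor
  · rintro ⟨p⟩
    rcases (reachable_of_walk_union_pendant₂ hS hR hdisj hY p.length p le_rfl).1 hX with h | ⟨hP, hr⟩ | ⟨hQ, hr⟩
    · exact Or.inl h
    · rcases hr with h | h
      · exact Or.inl (hP.trans h)
      · exact Or.inr (Or.inl ⟨hP, h⟩)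
    · rcases hr with h | h
      · exact Or.inr (Or.inr ⟨hQ, h⟩)
      · exact Or.inl (hQ.trans h)
  · rintro (h | ⟨hP, h⟩ | ⟨hQ, h⟩)
    · exact h.mono hξ
    · exact ((hP.mono hξ).trans hPQ').trans (h.mono hξ)
    · exact ((hQ.mono hξ).trans hPQ'.symm).trans (h.mono hξ)

/-- ★ **a face of `S` joined to both roots is linked to what either root is linked to.** [cite: KhristoforovSmirnov2021, §1.2 (arXiv v1 p. 2: `IP(ξ)` is a union of disjoint paths)] -/
theorem reachable_union_pendant₂_root_iff (hS : ∀ F ∈ S, ∀ j : Fin 3, side F j ∈ ξ ∪ E → side F j ∈ E)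
    (hR : ∀ F, F ∉ S → F ≠ P → F ≠ Q → ∀ j : Fin 3, side F j ∉ E) (hdisj : Disjoint ξ E) {A Y : HexVertex} (hA : A ∈ S) (hY : Y ∉ S)
    (hAP : (sideGraph E).Reachable A P) (hAQ : (sideGraph E).Reachable A Q) :
    (sideGraph (ξ ∪ E)).Reachable A Y ↔ (sideGraph ξ).Reachable P Y ∨ (sideGraph ξ).Reachable Q Y := by
  have hξ : sideGraph ξ ≤ sideGraph (ξ ∪ E) := ht2_sideGraph_mono Finset.subset_union_left
  have hE : sideGraph E ≤ sideGraph (ξ ∪ E) := ht2_sideGraph_mono Finset.subset_union_right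
  constructor
  · rintro ⟨p⟩
    exact (reachable_of_walk_union_pendant₂ hS hR hdisj hY p.length p le_rfl).2 hA
  · rintro (h | h)
    · exact (hAP.mono hE).trans (h.mono hξ)
    · exact (hAQ.mono hE).trans (h.mono hξ)

end TwoRoots

end Literature.Probability.Percolation.MarkedLoops
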